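import Summits.ABC.IUTFork.Cor312SettingPrVol
import Summits.ABC.IUTFork.Cor312PilotIdelesDH
import Summits.ABC.IUTFork.Cor312ProvenanceDH
import HarnessLib

/-!
# [IUTchIII] Corollary 3.12 — the NUMBER `−|log(q)|` of the print-normalised assembled real setting with the
# `q`-pilot region read off ideles IS `−deĝ(P_q) = −(1/2l)·log(q)` ([IUTchIV] p. 23), label by label

PROOF-ONLY record file (D-0012; no definitions) of the abc-iut cell (Cor. 3.12 sub-crew, seat abc-iut-c312-7, gen 3;
D-0067 TEAM A row A-0 coda «A-0 AT THE PRINT-NORMALISED SETTING»); TAKES NO SIDE. [IUTchIII] Cor. 3.12 (kurims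
`paper:url-4b091feeb646` p. 174 l. 4–13): "`−|log(q)| ∈ ℝ` [is] the procession-normalized mono-analytic log-volume of the
image of a `q`-pilot object … In particular, `|log(q)| > 0` is easily computed in terms of the various `q`-parameters of
the elliptic curve `E_F` … at `v ∈ 𝕍^bad (≠ ∅)`"; [IUTchIV] Thm. 1.10, kurims `paper:url-56bcb0f95768` p. 23 l. 27–30:
"the quantity “`|log(q)| ∈ ℝ_{>0}`” defined in [IUTchIII], Corollary 3.12, is equal to `(1/2l)·log(q) ∈ ℝ`" with
`log(q)` the NORMALIZED degree `(1/[F:ℚ])·Σ_{v bad} ord_v(q_v)·log N(v)` ([IUTchIV] Def. 1.9 (i)). THIS file computes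
that number IN THE KERNEL for this seat's verbatim `Cor312.Setting.negLogQ` (`Cor312Statement`, FROZEN) at
abc-iut-c312-1 (gen 5)'s PACKET-NORMALISED assembled real setting `Real.settingPrVol` (`Cor312SettingPrVol` p419741;
container `Real.summandPiecesPr` with the probability weights `Pr(v⃗) = Π_a n_{v_a}/[F:ℚ]^{j+1}` of Dupuy–Hilado §3.6)
whose `q`-centre is abc-iut-c312-3 (gen 4)'s `qCentreDH tq` read off `q`-pilot ideles `t_{q,v} ∈ F_v^×`
(`Cor312PilotIdelesDH` §2; Dupuy–Hilado §3.9), for ideles REALISING `P_q` in the normalisation (3.4)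
`log ‖t_{q,v}‖ = −P_q(v)·ln|κ(v)|/n_v` — the Θ-boxes stay a free binder (the `q`-number does not read them):

* §1 `logvol_preimage_pi_Pr_of_last` — the expectation identity behind Dupuy–Hilado's Thm. 3.10.1 (i): for a direct
  product region over `p` whose summand log-measures are `c(v_j)·log N(v_j)/n_{v_j}` (a function of the LAST place),
  the packet-normalised log-volume is `(1/[F:ℚ])·Σ_{v|p} c(v)·log N(v)` (`𝔼` over tuples of a last-coordinate quantity =
  `𝔼` over `𝕍(F)_p`, abc-iut-c312-3 `tupleWeights_expect_coord`; `Pr(v)/n_v = 1/[F:ℚ]`) — the pattern of abc-iut-c312-1's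
  `logvol_idealRegion_inr`, stated once for ARBITRARY real coefficients;
* §2 `qLocal_settingPrVol_qCentreDH_inr` — at a prime: `−|log(q)|_{j,p} = −(1/[F:ℚ])·Σ_{v|p} P_q(v)·log N(v)`
  (INDEPENDENT of the label `j` — the packet-normalisation at work; abc-iut-c312-1's certificate `Real.logvol_p_mul_DH`
  shows the constant-weighted `Real.settingDHVol` would carry the extra factor `(|𝕍(F)_p|/[F:ℚ])^{j}/n_v` here);
  `qLocal_settingPrVol_qCentreDH_inl = 0`; `finsum_qLocal_settingPrVol_qCentreDH = −deĝ(P_q)` at EVERY label;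
* §3 **`negLogQ_settingPrVol_qCentreDH`**: `P.negLogQ = −FinDivisor.ndeg F X.qPilot` — "`−|log(q)| = −deĝ(P_q)`"
  (Dupuy–Hilado Thm. 3.10.1 (iii) for the `q`-pilot) as a theorem ABOUT THE VERBATIM QUANTITY at the real setting; and,
  under abc-iut-c312-8's provenance link `IsPilotDataOf D X` (same `l`, `S = 𝕍(F)^bad`, `ord_v(q_v)`):
  **`negLogQ_settingPrVol_eq_neg_absLogq`** `P.negLogQ = −absLogq D = −(1/2l)·log(q)` — the field `IsSettingOf.negLogQ_eq`
  of `Cor312Provenance` DISCHARGED for this setting — and **`absLogQPos_settingPrVol_qCentreDH`** ("`|log(q)| > 0`").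
[claim: Mochizuki2012, status: disputed] for the quoted sentences; [cite: DupuyHilado2025, §3.3, §3.4, §3.6, §3.9,
Thm. 3.10.1]; [cite: Mochizuki2012, IUTchIV Def. 1.9 (i) p. 20, Thm. 1.10 p. 23]. HONEST FRAMING: a computation of one of
the two printed quantities at ONE instantiation; nothing here bears on `−|log(Θ)|` or on the inequality of Cor. 3.12;
the remaining fields of `IsSettingOf` (index bookkeeping over `D.V ≅ 𝕍_mod`) are abc-iut-c312-8's `Cor312ProvenanceReal`
lane and are not claimed here. Companions: `Cor312PilotIdelesPr` (the sharp Θ-boxes, `settingPrVolSharp`, to which every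
theorem below applies verbatim), `Cor312ThetaFinitePrVol`. typed ≠ proved; instantiated ≠ endorsed.
-/

noncomputable section

open Set Function NumberField IsDedekindDomain
open scoped Pointwise

namespace Summit.ABC

namespace IUTFork

namespace Thm311

namespace Real

open Cor312 Cor312Vol Literature.IUT.LogThetaLattice Literature.IUT.LogVolume Literature.IUT.HodgeTheaters

variable {F : Type} [Field F] [NumberField F] (X : PilotData F) {logv : PadicLogs F} (hlog : LogvAnalytic logv)

/-! ## §1. The expectation identity: `Σ_{v⃗} Pr(v⃗)·c(v_j)·log N(v_j)/n_{v_j} = (1/[F:ℚ])·Σ_{v|p} c(v)·log N(v)` -/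

/-- **Direct product regions whose summand log-measures depend on the LAST place through `c(v)·log N(v)/n_v` have
packet-normalised log-volume `(1/[F:ℚ])·Σ_{v|p} c(v)·log N(v)`** — the computation in Dupuy–Hilado's proof of Thm. 3.10.1
(i) at one prime ("`𝔼(ln|t_{v_{r−1}}|_p : (v_0,…,v_{r−1}) ∈ V(F₀)_p^r) = 𝔼(ln|t_v|_p : v ∈ V(F₀)_p)`", then
`Pr(v)/n_v = 1/[F₀:ℚ]`), for arbitrary real coefficients `c`. [cite: DupuyHilado2025, Thm. 3.10.1] -/
theorem logvol_preimage_pi_Pr_of_last (pp : Nat.Primes) (j : (thetaIndex X).Label)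
    (R : ∀ e : (thetaIndex X).Caps j → (thetaIndex X).Fibre (.inr pp),
      haveI : Fact (pp : ℕ).Prime := ⟨pp.2⟩; Set ((presAtPr X hlog pp).X e))
    (hR : ∀ e, haveI : Fact (pp : ℕ).Prime := ⟨pp.2⟩; PacketAdm pp.1 ((presAtPr X hlog pp).kk e) (R e))
    (c : HeightOneSpectrum (𝓞 F) → ℝ)
    (hc : ∀ e, haveI : Fact (pp : ℕ).Prime := ⟨pp.2⟩;
      packetLogμ pp.1 ((presAtPr X hlog pp).kk e) (R e) =
        c (placeOf X pp.1 (e (Fin.last _))) * logNorm F (placeOf X pp.1 (e (Fin.last _))) /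
          localDegree F (placeOf X pp.1 (e (Fin.last _)))) :
    haveI : Fact (pp : ℕ).Prime := ⟨pp.2⟩
    (summandPiecesPr X hlog).logvol j (.inr pp) ((presAtPr X hlog pp).comparison j ⁻¹' Set.pi univ R) =
      (∑ v ∈ placesOver F pp, c v * logNorm F v) / Module.finrank ℚ F := by
  haveI : Fact (pp : ℕ).Prime := ⟨pp.2⟩
  have hμ : ∀ e, (summandPiecesPr X hlog).logμ j (.inr pp) e (R e) =
      c (placeOf X pp.1 (e (Fin.last _))) * logNorm F (placeOf X pp.1 (e (Fin.last _))) /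
        localDegree F (placeOf X pp.1 (e (Fin.last _))) := fun e => hc e
  refine ((summandPiecesPr X hlog).logvol_preimage_pi j (.inr pp) (R := R) hR).trans ?_
  simp only [hμ]
  refine Eq.trans (b := ∑ e' : Fin ((j : ℕ) + 1) → placesOver F pp,
    c (e' (Fin.last _)).1 * logNorm F (e' (Fin.last _)).1 / localDegree F (e' (Fin.last _)).1 *
      (tupleWeights F pp (j : ℕ)).pr e') ?_ ?_
  · exact Finset.sum_equiv
      (Equiv.arrowCongr (Equiv.refl ((thetaIndex X).Caps j)) (fibreEquivPlacesOver X pp))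
      (fun _ => ⟨fun _ => Finset.mem_univ _, fun _ => Finset.mem_univ _⟩)
      (fun e _ => by rw [mul_comm]; rfl)
  refine (tupleWeights_expect_coord F pp (j : ℕ) (Fin.last _)
    (fun v : placesOver F pp => c v.1 * logNorm F v.1 / localDegree F v.1)).trans ?_
  have h2 := expect_neg_deg_div_localDegree' F pp fun v => -c v.1
  simp only [neg_mul, neg_neg] at h2
  rw [h2, FinDivisor.ndeg_apply, map_sum, ← neg_div, ← Finset.sum_neg_distrib]
  congr 1
  rw [← Finset.sum_coe_sort (placesOver F pp)]
  refine Finset.sum_congr rfl fun v _ => ?_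
  rw [FinDivisor.deg_of]
  ring

/-! ## §2. The local `q`-volumes of the print-normalised setting with the `q`-centre read off ideles -/

section QNumber

variable (M : Type) [Field M] [NumberField M]
  (archPk : ∀ (j : (thetaIndex X).Label) (vQ : (thetaIndex X).VQ), Set ((logShellsDH X logv).Packet j vQ))
  (archSub : ∀ (j : (thetaIndex X).Label) (v : (thetaIndex X).V),
    Set ((logShellsDH X logv).Packet j ((thetaIndex X).over v)))
  (Ψ : ℤ → ∀ v : (thetaIndex X).V, v ∈ (thetaIndex X).Vbad → Set ((logShellsDH X logv).StarPacket v))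
  (act : ℤ → ∀ v : (thetaIndex X).V, v ∈ (thetaIndex X).Vbad →
    (logShellsDH X logv).StarPacket v → Module.End ℚ ((logShellsDH X logv).StarPacket v))
  (Mmod : ℤ → ∀ j : (thetaIndex X).LabelStar, Set ((logShellsDH X logv).GlobalPacket j.1))
  (region : ℤ → ∀ j : (thetaIndex X).LabelStar, FinDivisor M → ∀ vQ : (thetaIndex X).VQ,
    Set ((logShellsDH X logv).Packet j.1 vQ))
  (n : ℤ) {HT : Type} {LogLink : HT → HT → Type} {IsFull : ∀ {s t : HT}, LogLink s t → Prop}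
  (lat : LGPGaussianLogThetaLattice LogLink IsFull)
  {Frd : Type} {IsoF : Frd → Frd → Type} {Ob : Frd → Type} {realify : Frd → Frd} {Strip : Type}
  {IsoS : Strip → Strip → Type} {Mv : ∀ v : (thetaIndex X).V, v ∈ (thetaIndex X).Vbad → Type}
  [∀ v h, Monoid (Mv v h)]
  (sig : GlobalLGPFrobenioidSignature (thetaIndex X).lstar (thetaIndex X).V (· ∈ (thetaIndex X).Vbad)
    Frd IsoF Ob realify Strip IsoS Mv)
  (split : SplittingMonoids Mv) {ObΔ : Type} {N : ∀ v : (thetaIndex X).V, v ∈ (thetaIndex X).Vbad → Type}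
  [∀ v h, Monoid (N v h)] (qData : QPilotData ObΔ N)
  (thetaBox : ℤ → Ob sig.Clgp → ∀ (j : (thetaIndex X).Label) (vQ : (thetaIndex X).VQ),
    Set (∀ s : factorIdxDH X hlog j vQ, factorFieldDH X hlog j vQ s))
  (tq : ∀ (pp : Nat.Primes) (x : (thetaIndex X).Fibre (.inr pp)), haveI : Fact (pp : ℕ).Prime := ⟨pp.2⟩; kOf X pp.1 x)
  (htq0 : ∀ pp x, tq pp x ≠ 0)
  (hfin : ∀ j : (thetaIndex X).Label, (Function.support fun vQ =>
    ((situationPrVol X hlog M archPk archSub Ψ act Mmod region).D n).logvol j vQ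
      (factorMapDH X hlog j vQ ⁻¹' hullSet (factorFieldDH X hlog j vQ) (qCentreDH X hlog tq j vQ))).Finite)
  /- the `q`-ideles REALISE `P_q` in Dupuy–Hilado's normalisation (3.4): `log ‖t_{q,v}‖ = −P_q(v)·ln|κ(v)|/n_v` -/
  (htq : ∀ (pp : Nat.Primes) (x : (thetaIndex X).Fibre (.inr pp)),
    haveI : Fact (pp : ℕ).Prime := ⟨pp.2⟩
    Real.log ‖tq pp x‖ = -(X.qPilot (placeOf X pp.1 x)) * logNorm F (placeOf X pp.1 x) /
      localDegree F (placeOf X pp.1 x))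

/-- At the archimedean place the local `q`-volume is `0` (trivial archimedean container of the parent files — weights
`0`; the honest archimedean twin `Thm311RealDegreeArch` also gives `0` on the unit region). [folklore] -/
theorem qLocal_settingPrVol_qCentreDH_inl (j : (thetaIndex X).Label) (u : Unit) :
    (settingPrVol X hlog M archPk archSub Ψ act Mmod region n lat sig split qData thetaBox (fun _ => qCentreDH X hlog tq)
        (fun j vQ s => qCentreDH_ne_zero X hlog tq htq0 j vQ s) hfin).qLocal j (.inl u) = 0 := by
  show ∑ e, (summandPiecesPr X hlog).w j (.inl u) e * _ = 0
  exact Finset.sum_eq_zero fun e _ => by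
    rw [show (summandPiecesPr X hlog).w j (.inl u) e = 0 from rfl, zero_mul]

include htq

/-- **`−|log(q)|` locally at a prime, print-normalised**: for `q`-ideles realising `P_q`, the local `q`-volume of the
setting `settingPrVol … (qCentreDH tq) …` at `(j, p)` is `−(1/[F:ℚ])·Σ_{v|p} P_q(v)·log N(v)` — for EVERY label `j`
(§1 with `c := −P_q`; the `q`-region is `e⁻¹(Π_{v⃗} ι_j(t_{q,v_j})·(R_I)^∼)`, abc-iut-c312-3's
`factorMap_preimage_hullSet_centreOf`, with summand log-measures `log ‖t_{q,v_j}‖`, (3.7)). [cite: DupuyHilado2025, §3.9, Thm. 3.10.1] -/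
theorem qLocal_settingPrVol_qCentreDH_inr (j : (thetaIndex X).Label) (pp : Nat.Primes) :
    (settingPrVol X hlog M archPk archSub Ψ act Mmod region n lat sig split qData thetaBox (fun _ => qCentreDH X hlog tq)
        (fun j vQ s => qCentreDH_ne_zero X hlog tq htq0 j vQ s) hfin).qLocal j (.inr pp) =
      (∑ v ∈ placesOver F pp, -(X.qPilot v) * logNorm F v) / Module.finrank ℚ F := by
  haveI : Fact (pp : ℕ).Prime := ⟨pp.2⟩
  haveI : Nonempty ((thetaIndex X).Caps j) := ⟨0⟩
  have hg : ∀ (e : (thetaIndex X).Caps j → (thetaIndex X).Fibre (.inr pp)) (i : DIdx pp.1 ((presAtPr X hlog pp).kk e)),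
      dEquiv pp.1 ((presAtPr X hlog pp).kk e)
        (iota pp.1 ((presAtPr X hlog pp).kk e) (Fin.last _) (tq pp (e (Fin.last _)))) i ≠ 0 :=
    fun e i => dEquiv_iota_ne_zero pp.1 _ (Fin.last _) (htq0 pp _) i
  have h := (presAtPr X hlog pp).factorMap_preimage_hullSet_centreOf
    (fun e => iota pp.1 ((presAtPr X hlog pp).kk e) (Fin.last _) (tq pp (e (Fin.last _)))) hg
  have hadm : ∀ e : (thetaIndex X).Caps j → (thetaIndex X).Fibre (.inr pp),
      PacketAdm pp.1 ((presAtPr X hlog pp).kk e)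
        (iota pp.1 ((presAtPr X hlog pp).kk e) (Fin.last _) (tq pp (e (Fin.last _))) •
          (normalizedPacket pp.1 ((presAtPr X hlog pp).kk e) : Set ((presAtPr X hlog pp).X e))) :=
    fun e => packetAdm_iota_smul pp.1 _ (Fin.last _) (htq0 pp _) (packetAdm_normalizedPacket pp.1 _)
  change (summandPiecesPr X hlog).logvol j (.inr pp)
    ((fun x => (presAtPr X hlog pp).factorMap j x) ⁻¹'
      hullSet ((presAtPr X hlog pp).factorField j) ((presAtPr X hlog pp).centreOf fun e =>
        iota pp.1 ((presAtPr X hlog pp).kk e) (Fin.last _) (tq pp (e (Fin.last _))))) = _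
  rw [h]
  refine logvol_preimage_pi_Pr_of_last X hlog pp j _ hadm (fun v => -(X.qPilot v)) fun e => ?_
  rw [packetLogμ_iota_smul_normalizedPacket pp.1 _ (Fin.last _) (htq0 pp _)]
  exact htq pp _

open scoped Classical in
/-- The local `q`-volumes vanish off the primes under the support of `P_q` (`⊆ S`): "all but finitely many of which
are zero!" ([IUTchIII] Prop. 3.9 (iii)). [claim: Mochizuki2012, status: disputed] -/
theorem support_qLocal_settingPrVol_qCentreDH_subset (j : (thetaIndex X).Label) :
    (Function.support fun vQ : (thetaIndex X).VQ =>
        (settingPrVol X hlog M archPk archSub Ψ act Mmod region n lat sig split qData thetaBox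
          (fun _ => qCentreDH X hlog tq) (fun j vQ s => qCentreDH_ne_zero X hlog tq htq0 j vQ s) hfin).qLocal j vQ) ⊆
      ↑(X.qPilot.support.image fun v => (thetaIndex X).over (.inr v : Place F)) := by
  intro vQ hvQ
  rw [Function.mem_support] at hvQ
  rcases vQ with u | pp
  · exact absurd (qLocal_settingPrVol_qCentreDH_inl X hlog M archPk archSub Ψ act Mmod region n lat sig split qData
      thetaBox tq htq0 hfin j u) hvQ
  · haveI : Fact (pp : ℕ).Prime := ⟨pp.2⟩
    rw [qLocal_settingPrVol_qCentreDH_inr X hlog M archPk archSub Ψ act Mmod region n lat sig split qData thetaBox tq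
      htq0 hfin htq j pp] at hvQ
    obtain ⟨v, hv, hJv⟩ : ∃ v ∈ placesOver F pp, -(X.qPilot v) * logNorm F v ≠ 0 := by
      by_contra hcon
      simp only [not_exists, not_and, not_not] at hcon
      exact hvQ (by rw [Finset.sum_eq_zero hcon, zero_div])
    rw [Finset.coe_image, Set.mem_image]
    refine ⟨v, Finset.mem_coe.mpr (Finsupp.mem_support_iff.mpr fun h0 => hJv (by simp [h0])), ?_⟩
    rw [over_inr_eq]
    exact congrArg Sum.inr (Subtype.ext ((mem_placesOver_iff_residueChar v).mp hv))

open scoped Classical in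
/-- **The global `q`-volume at every label is `−deĝ(P_q)`**: `Σ_{v_ℚ} −|log(q)|_{j,v_ℚ} = −(1/[F:ℚ])·Σ_v P_q(v)·log N(v)
= −FinDivisor.ndeg F X.qPilot` ([IUTchIII] Prop. 3.9 (iii): the global log-volume of the region determined by an
arithmetic line bundle is its normalized degree; Dupuy–Hilado Thm. 3.10.1 for the `q`-pilot, prime by prime).
[cite: DupuyHilado2025, Thm. 3.10.1] -/
theorem finsum_qLocal_settingPrVol_qCentreDH (j : (thetaIndex X).Label) :
    ∑ᶠ vQ : (thetaIndex X).VQ,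
        (settingPrVol X hlog M archPk archSub Ψ act Mmod region n lat sig split qData thetaBox
          (fun _ => qCentreDH X hlog tq) (fun j vQ s => qCentreDH_ne_zero X hlog tq htq0 j vQ s) hfin).qLocal j vQ =
      -FinDivisor.ndeg F X.qPilot := by
  rw [finsum_eq_sum_of_support_subset _ (support_qLocal_settingPrVol_qCentreDH_subset X hlog M archPk archSub Ψ act Mmod
    region n lat sig split qData thetaBox tq htq0 hfin htq j)]
  -- the sum over the primes under the support of `P_q`, prime by prime
  have hterm : ∀ vQ ∈ X.qPilot.support.image fun v => (thetaIndex X).over (.inr v : Place F),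
      (settingPrVol X hlog M archPk archSub Ψ act Mmod region n lat sig split qData thetaBox
          (fun _ => qCentreDH X hlog tq) (fun j vQ s => qCentreDH_ne_zero X hlog tq htq0 j vQ s) hfin).qLocal j vQ =
        (∑ v ∈ X.qPilot.support with (thetaIndex X).over (.inr v : Place F) = vQ, -(X.qPilot v) * logNorm F v) /
          Module.finrank ℚ F := by
    intro vQ hvQ
    obtain ⟨v₀, -, rfl⟩ := Finset.mem_image.mp hvQ
    haveI : Fact (residueChar F v₀).Prime := ⟨residueChar_prime F v₀⟩
    have h := qLocal_settingPrVol_qCentreDH_inr X hlog M archPk archSub Ψ act Mmod region n lat sig split qData thetaBox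
      tq htq0 hfin htq j ⟨residueChar F v₀, residueChar_prime F v₀⟩
    rw [show (Sum.inr ⟨residueChar F v₀, residueChar_prime F v₀⟩ : (thetaIndex X).VQ) =
      (thetaIndex X).over (.inr v₀ : Place F) from rfl] at h
    rw [h]
    congr 1
    symm
    apply Finset.sum_subset
    · intro v hv
      rw [Finset.mem_filter] at hv
      have h1 := hv.2
      rw [over_inr_eq, over_inr_eq] at h1
      exact (mem_placesOver_iff_residueChar v).mpr (congrArg Subtype.val (Sum.inr.inj h1))
    · intro v hv hv'
      rw [Finset.mem_filter, not_and'] at hv'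
      have hres : (thetaIndex X).over (.inr v : Place F) = (thetaIndex X).over (.inr v₀ : Place F) := by
        rw [over_inr_eq, over_inr_eq]
        exact congrArg Sum.inr (Subtype.ext ((mem_placesOver_iff_residueChar v).mp hv))
      have hJ : X.qPilot v = 0 := Finsupp.notMem_support_iff.mp (hv' hres)
      simp [hJ]
  rw [Finset.sum_congr rfl hterm, ← Finset.sum_div, Finset.sum_fiberwise_of_maps_to
    (g := fun v => (thetaIndex X).over (.inr v : Place F))
    (fun v hv => Finset.mem_image_of_mem (fun v => (thetaIndex X).over (.inr v : Place F)) hv),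
    FinDivisor.ndeg_apply, FinDivisor.deg_apply, Finsupp.sum, ← neg_div, ← Finset.sum_neg_distrib]
  refine congrArg (· / _) (Finset.sum_congr rfl fun v _ => ?_)
  ring

/-! ## §3. `−|log(q)| = −deĝ(P_q) = −(1/2l)·log(q)` and `|log(q)| > 0` -/

/-- **`−|log(q)| = −deĝ(P_q)`**: the verbatim procession-normalized quantity `negLogQ` of [IUTchIII] Cor. 3.12 (this
seat's `Cor312Statement`, p. 174 l. 4–10) AT the print-normalised assembled real setting with the `q`-pilot region read
off ideles realising `P_q` IS minus the normalized degree of Dupuy–Hilado's `q`-pilot divisor (the average over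
`j ∈ 𝔽_l^⋇` of a `j`-independent quantity). [cite: DupuyHilado2025, Thm. 3.10.1] -/
theorem negLogQ_settingPrVol_qCentreDH :
    (settingPrVol X hlog M archPk archSub Ψ act Mmod region n lat sig split qData thetaBox (fun _ => qCentreDH X hlog tq)
        (fun j vQ s => qCentreDH_ne_zero X hlog tq htq0 j vQ s) hfin).negLogQ = -FinDivisor.ndeg F X.qPilot := by
  unfold Setting.negLogQ
  simp_rw [finsum_qLocal_settingPrVol_qCentreDH X hlog M archPk archSub Ψ act Mmod region n lat sig split qData thetaBox
    tq htq0 hfin htq]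
  exact processionNormalized_const (lt_of_lt_of_le two_pos X.two_le_lstar) _

/-- **`−|log(q)| = −(1/2l)·log(q)` of the initial Θ-data** ([IUTchIV] Thm. 1.10, p. 23 l. 27–30 "the quantity
“`|log(q)|`” defined in [IUTchIII], Corollary 3.12, is equal to `(1/2l)·log(q)`"): under abc-iut-c312-8's provenance link
`IsPilotDataOf D X` (same `l`, `S = 𝕍(F)^bad`, `ord_v(q_v)` of [IUTchI] Def. 3.1 (c)), the field `negLogQ_eq` of
`Cor312Prov.IsSettingOf` HOLDS for the print-normalised assembled real setting with the `q`-region read off realising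
ideles (`Cor312Prov.absLogq_eq_ndeg_qPilot`). [claim: Mochizuki2012, status: disputed] -/
theorem negLogQ_settingPrVol_eq_neg_absLogq {K Fbar : Type} [Field K] [NumberField K] [Algebra F K] [Field Fbar]
    [Algebra F Fbar] [Algebra K Fbar] {E : WeierstrassCurve F} [E.IsElliptic] {l : ℕ} {Pb : BadPlacePredicates K}
    {D : InitialThetaData F K Fbar E l Pb} (hX : Cor312Prov.IsPilotDataOf D X) :
    (settingPrVol X hlog M archPk archSub Ψ act Mmod region n lat sig split qData thetaBox (fun _ => qCentreDH X hlog tq)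
        (fun j vQ s => qCentreDH_ne_zero X hlog tq htq0 j vQ s) hfin).negLogQ = -Cor312Prov.absLogq D := by
  rw [negLogQ_settingPrVol_qCentreDH X hlog M archPk archSub Ψ act Mmod region n lat sig split qData thetaBox tq htq0 hfin
    htq, Cor312Prov.absLogq_eq_ndeg_qPilot hX]

/-- **"In particular, `|log(q)| > 0`"** (Cor. 3.12, p. 174 l. 13; this seat's `AbsLogQPos := negLogQ < 0`) for the
print-normalised assembled real setting with the `q`-region read off realising ideles: `deĝ(P_q) > 0` (`S ≠ ∅`,
`ord_v(q_v) > 0`, `ln|κ(v)| > 0` — abc-iut-c312-3 `deg_qPilot_pos`). [claim: Mochizuki2012, status: disputed] -/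
theorem absLogQPos_settingPrVol_qCentreDH :
    (settingPrVol X hlog M archPk archSub Ψ act Mmod region n lat sig split qData thetaBox (fun _ => qCentreDH X hlog tq)
        (fun j vQ s => qCentreDH_ne_zero X hlog tq htq0 j vQ s) hfin).AbsLogQPos := by
  unfold Setting.AbsLogQPos
  rw [negLogQ_settingPrVol_qCentreDH X hlog M archPk archSub Ψ act Mmod region n lat sig split qData thetaBox tq htq0 hfin
    htq, neg_lt_zero, FinDivisor.ndeg_apply]
  exact div_pos X.deg_qPilot_pos FinDivisor.finrank_pos

end QNumber

end Real

end Thm311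

end IUTFork

end Summit.ABC

end
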